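import Summits.BirchSwinnertonDyer.BirchSwinnertonDyer.Theorems.AlignedTransportAtTwoMainConjectureTransportAlignedAtTwoKilfordCopyCrossLevelTwoSided
import Summits.BirchSwinnertonDyer.BirchSwinnertonDyer.Theorems.AlignedTransportAtTwoMainConjectureTransportAlignedAtTwoKilfordCopyCrossLevelSquarefreeConductor
import Summits.BirchSwinnertonDyer.BirchSwinnertonDyer.Theorems.AlignedTransportAtTwoMainConjectureTransportAlignedAtTwoKilfordCopyOfPrint
import HarnessLib

/-!
# Crux C1 `MainConjectureTransportAlignedAtTwo` (stmt-BirchSwinnertonDyer-22296), line `birth`, residual (R2) `stub_lamLawKilford`, UNEQUAL conductors: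
# THE INTERMEDIATE-LEVEL REDUCTION in the crux's currency, TWO-SIDED SHAPE `N(W₁) = N₀·∏Q₁`, `N(W₂) = N₀·∏Q₂` — e.g. EVERY PAIR OF SEMISTABLE CURVES:
# v27's inline cross-level stub on this shape FROM «PLANE(2) at the common level `L = N(W₁)·∏Q₂` for the two old lines» + the Kraus–Oesterlé parities
# (width seat att-p3 g18; `--supports 22296`)

THEOREMS ONLY (no `def`, no `sorry`, no named fact). Sequel of `…KilfordCopyCrossLevelTwoSided` (`sameKernel_depleted_of_sameKernel_twoOldLinesSets`,
`two_dvd_LFunction_sub_of_conductorNorm_eq_mul_mul`, `exists_semistableShape`) in the style of `…KilfordCopyCrossLevelSquarefreeConductor` §2–§3 (the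
one-sided case `Q₁ = ∅`). Pure bookkeeping; BSD is not proved by this; C1 is not closed by this; the cross-level input of (R2) is REDUCED, not discharged.

* §1 **`uniformize_depleted_iff_of_twoOldLinesSets_conductor`** — for `D₁, D₂` at the conductor levels, `N(W₁) = N₀·∏Q₁`, `N(W₂) = N₀·∏Q₂` (`Q₁, Q₂`
  disjoint sets of primes not dividing `N₀`), the old lines `F₁` (of `f₁` by `Q₂`) and `F₂` (of `f₂` by `Q₁`) at `L = N(W₁)·∏Q₂`, `S ⊇ Q₁ ∪ Q₂` odd primes with
  `S ∖ (Q₁ ∪ Q₂) ⊆` primes of `N₀`, and the TWO Kraus–Oesterlé families `a_q(W₁)` even (`q ∈ Q₂`), `a_q(W₂)` even (`q ∈ Q₁`) (every other parity comes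
  from the conductors): same half-kernel at level `L` of `(c₁·y(F₁), c₂·y(F₂))` ⟹ same depleted half-kernel.
* §2 **`sameDepletedKernel_semistableShape_of_twoOldLinesPlane`** — the BODY of v27's inline stub `stub_sameDepletedCopyKilfordNe` / `hCopyNe` with its
  binder `N(W₁) ≠ N(W₂)` specialised to the two-sided shape, from `hPlane` (PLANE(2) at the common level for the two old lines, ∀-binder form; att-p5 g18's
  fourth engine: lcm-type aligned 2/2 same plane, misaligned 7/7 meet in 0) and `hKO` (the two KO families, Kraus–Oesterlé 1992 Prop. 3 at `p = 2`).
  With `…TwoSided.exists_semistableShape` this covers every pair of semistable curves on the stratum.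

References: Greenberg–Vatsal 2000 §3 [GreenbergVatsal2000]; Cremona 1997 §2.4, §2.10 [CremonaAlgorithms1997]; Kraus–Oesterlé 1992 Prop. 3 [KrausOesterle1992];
Silverman ATAEC IV.10.2 [Silverman1994]; Kilford–Wiese 2008 Question 1.9 (reading) [KilfordWiese2008].
-/

noncomputable section

-- justification: the `Summit.BirchSwinnertonDyer.BirchSwinnertonDyer.…` path repeats a component (route-file convention)
set_option linter.dupNamespace false
set_option autoImplicit false

open scoped MatrixGroups ModularForm Classical

open CongruenceSubgroup Complex WeierstrassCurve IsDedekindDomain Polynomial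
open Literature.NumberTheory.EllipticCurves Literature.NumberTheory.EllipticCurves.ModularForms
open Literature.NumberTheory.EllipticCurves.Greenberg1999
open Summit.BirchSwinnertonDyer.Rank1Residual.F1Sign2
open Summit.BirchSwinnertonDyer.BirchSwinnertonDyer.Theorems.AlignedTransportAtTwoKilfordCopyCrossLevelSquarefreePairs (exists_oldLines)
open Summit.BirchSwinnertonDyer.BirchSwinnertonDyer.Theorems.AlignedTransportAtTwoKilfordCopyCrossLevelSquarefreeConductor (odd_LFunction_of_dvd_conductorNorm_eq_mul)
open Summit.BirchSwinnertonDyer.BirchSwinnertonDyer.Theorems.AlignedTransportAtTwoKilfordCopyCrossLevelTwoSided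

namespace Summit.BirchSwinnertonDyer.BirchSwinnertonDyer.Theorems.AlignedTransportAtTwoKilfordCopyCrossLevelSemistable

/-! ## §1 The reduction in the crux's currency at the conductor levels, two-sided shape -/

/-- **The cross-level hypothesis of (R2) at the conductor levels, two-sided shape `N(W₁) = N₀·∏Q₁`, `N(W₂) = N₀·∏Q₂`, parities discharged except the
Kraus–Oesterlé ones** (`a_q(W₁)` even for `q ∈ Q₂`, `a_q(W₂)` even for `q ∈ Q₁`): same half-kernel at the common level `L = N(W₁)·∏Q₂` of
`(c₁·y(F₁), c₂·y(F₂))` (`Fᵢ` the old lines) ⟹ same depleted half-kernel at `N'`.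
[cite: KrausOesterle1992, Prop. 3 (p. 262–263)] [cite: Silverman1994, IV.10.2] [cite: GreenbergVatsal2000, §3] [cite: CremonaAlgorithms1997, §2.4 and §2.10] -/
theorem uniformize_depleted_iff_of_twoOldLinesSets_conductor
    {W₁ W₂ : WeierstrassCurve ℚ} [W₁.IsElliptic] [W₂.IsElliptic] [NeZero (W₁.conductorNorm ℤ)] [NeZero (W₂.conductorNorm ℤ)]
    (D₁ : ModularParametrizationData W₁ (W₁.conductorNorm ℤ)) (D₂ : ModularParametrizationData W₂ (W₂.conductorNorm ℤ))
    (N₀ : ℕ) (Q₁ Q₂ : Finset ℕ) (hQ₁ : ∀ q ∈ Q₁, q.Prime) (hQ₂ : ∀ q ∈ Q₂, q.Prime) (hdisj : Disjoint Q₁ Q₂)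
    (hQ₁N₀ : ∀ q ∈ Q₁, ¬ q ∣ N₀) (hQ₂N₀ : ∀ q ∈ Q₂, ¬ q ∣ N₀)
    (hN₁ : W₁.conductorNorm ℤ = N₀ * ∏ q ∈ Q₁, q) (hN₂ : W₂.conductorNorm ℤ = N₀ * ∏ q ∈ Q₂, q)
    {L : ℕ} [NeZero L] (hL : L = W₁.conductorNorm ℤ * ∏ q ∈ Q₂, q)
    (hq₁ : ∀ q ∈ Q₂, Even (W₁.LFunction q)) (hq₂ : ∀ q ∈ Q₁, Even (W₂.LFunction q))
    (S : Finset ℕ) (hS : ∀ ℓ ∈ S, ℓ.Prime) (hSodd : ∀ ℓ ∈ S, Odd ℓ) (hQ₁S : Q₁ ⊆ S) (hQ₂S : Q₂ ⊆ S)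
    (hSN : ∀ ℓ ∈ S, ℓ ∉ Q₁ → ℓ ∉ Q₂ → ℓ ∣ N₀)
    (N' : ℕ) [NeZero N'] (hN' : L * ∏ ℓ ∈ S, ℓ ^ 2 ∣ N')
    (g₁ g₂ : CuspForm (Gamma0 N') 2)
    (hg₁ : ∀ n, cuspCoeff g₁ n = if ∃ ℓ ∈ S, ℓ ∣ n then 0 else cuspCoeff D₁.f n)
    (hg₂ : ∀ n, cuspCoeff g₂ n = if ∃ ℓ ∈ S, ℓ ∣ n then 0 else cuspCoeff D₂.f n)
    (F₁ F₂ : CuspForm (Gamma0 L) 2)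
    (hF₁ : ∀ n : ℕ, cuspCoeff F₁ n =
      ∑ T ∈ Q₂.powerset, ((∏ q ∈ T, q : ℕ) : ℂ) * (if (∏ q ∈ T, q) ∣ n then cuspCoeff D₁.f (n / ∏ q ∈ T, q) else 0))
    (hF₂ : ∀ n : ℕ, cuspCoeff F₂ n =
      ∑ T ∈ Q₁.powerset, ((∏ q ∈ T, q : ℕ) : ℂ) * (if (∏ q ∈ T, q) ∣ n then cuspCoeff D₂.f (n / ∏ q ∈ T, q) else 0))
    (hker : ∀ y ∈ periodHomology L,
      D₁.uniformize ((D₁.c : ℂ) * y F₁ / 2) = 0 ↔ D₂.uniformize ((D₂.c : ℂ) * y F₂ / 2) = 0) :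
    ∀ x ∈ periodHomology N',
      D₁.uniformize ((D₁.c : ℂ) * ((((∏ ℓ ∈ S, ℓ ^ 2 : ℕ) : ℂ) * x g₁) / 2)) = 0 ↔
        D₂.uniformize ((D₂.c : ℂ) * ((((∏ ℓ ∈ S, ℓ ^ 2 : ℕ) : ℂ) * x g₂) / 2)) = 0 := by
  classical
  intro x hx
  rw [D₁.uniformize_eq_zero_iff, D₂.uniformize_eq_zero_iff, ← mul_div_assoc, ← mul_div_assoc]
  have hT₁ : ∀ (p : ℕ) (hp : p.Prime), (haveI : NeZero p := ⟨hp.ne_zero⟩; heckeT (Gamma0 (W₁.conductorNorm ℤ)) 2 p D₁.f) =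
      cuspCoeff D₁.f p • D₁.f :=
    fun p hp ↦ by haveI : NeZero p := ⟨hp.ne_zero⟩; exact D₁.isNewformOf.1.heckeT_eq_coeff_smul hp
  have hT₂ : ∀ (p : ℕ) (hp : p.Prime), (haveI : NeZero p := ⟨hp.ne_zero⟩; heckeT (Gamma0 (W₂.conductorNorm ℤ)) 2 p D₂.f) =
      cuspCoeff D₂.f p • D₂.f :=
    fun p hp ↦ by haveI : NeZero p := ⟨hp.ne_zero⟩; exact D₂.isNewformOf.1.heckeT_eq_coeff_smul hp
  have hdvdQ : ∀ (Q : Finset ℕ), (∀ q ∈ Q, q.Prime) → ∀ ℓ : ℕ, ℓ.Prime → ℓ ∉ Q → ¬ ℓ ∣ ∏ q ∈ Q, q := by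
    intro Q hQ ℓ hℓ hℓQ h
    obtain ⟨q, hq, hℓq⟩ := (Prime.dvd_finsetProd_iff hℓ.prime _).mp h
    exact hℓQ (((Nat.prime_dvd_prime_iff_eq hℓ (hQ q hq)).mp hℓq) ▸ hq)
  have hsq : ∀ (Q : Finset ℕ), (∀ q ∈ Q, q.Prime) → ∀ q ∈ Q, ¬ q ^ 2 ∣ ∏ q' ∈ Q, q' := by
    intro Q hQ q hq h
    rw [← Finset.mul_prod_erase Q (fun q' ↦ q') hq, pow_two] at h
    obtain ⟨q', hq', hqq'⟩ := (Prime.dvd_finsetProd_iff (hQ q hq).prime _).mp (Nat.dvd_of_mul_dvd_mul_left (hQ q hq).pos h)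
    exact Finset.ne_of_mem_erase hq' (((Nat.prime_dvd_prime_iff_eq (hQ q hq) (hQ q' (Finset.mem_of_mem_erase hq'))).mp hqq').symm)
  -- `Q₁`-primes do not divide `N(W₂)`, `Q₂`-primes do not divide `N(W₁)`
  have hQ₁N₂ : ∀ q ∈ Q₁, ¬ q ∣ W₂.conductorNorm ℤ := by
    intro q hq h
    rw [hN₂] at h
    rcases (Nat.Prime.dvd_mul (hQ₁ q hq)).mp h with h | h
    · exact hQ₁N₀ q hq h
    · exact hdvdQ Q₂ hQ₂ q (hQ₁ q hq) (Finset.disjoint_left.mp hdisj hq) h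
  have hQ₂N₁ : ∀ q ∈ Q₂, ¬ q ∣ W₁.conductorNorm ℤ := by
    intro q hq h
    rw [hN₁] at h
    rcases (Nat.Prime.dvd_mul (hQ₂ q hq)).mp h with h | h
    · exact hQ₂N₀ q hq h
    · exact hdvdQ Q₁ hQ₁ q (hQ₂ q hq) (Finset.disjoint_right.mp hdisj hq) h
  -- the conductor parities
  have h₂₂ : ∀ q ∈ Q₂, Odd (W₂.LFunction q) := fun q hq ↦
    odd_LFunction_of_dvd_conductorNorm_eq_mul W₂ (hQ₂ q hq) (hQ₂N₀ q hq) (Finset.dvd_prod_of_mem _ hq) (hsq Q₂ hQ₂ q hq) hN₂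
  have h₁₁ : ∀ q ∈ Q₁, Odd (W₁.LFunction q) := fun q hq ↦
    odd_LFunction_of_dvd_conductorNorm_eq_mul W₁ (hQ₁ q hq) (hQ₁N₀ q hq) (Finset.dvd_prod_of_mem _ hq) (hsq Q₁ hQ₁ q hq) hN₁
  have hAS : ∀ ℓ ∈ S, ℓ ∉ Q₁ → ℓ ∉ Q₂ → (2 : ℤ) ∣ W₁.LFunction ℓ - W₂.LFunction ℓ := fun ℓ hℓ h1 h2 ↦
    two_dvd_LFunction_sub_of_conductorNorm_eq_mul_mul W₁ W₂ hN₁ hN₂ (hS ℓ hℓ) (hdvdQ Q₁ hQ₁ ℓ (hS ℓ hℓ) h1)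
      (hdvdQ Q₂ hQ₂ ℓ (hS ℓ hℓ) h2) (hSN ℓ hℓ h1 h2)
  have hL₂ : L = W₂.conductorNorm ℤ * ∏ q ∈ Q₁, q := by rw [hL, hN₁, hN₂]; ring
  have hker' : ∀ y ∈ periodHomology L,
      (D₁.c : ℂ) * y F₁ / 2 ∈ D₁.L.lattice.toAddSubgroup ↔ (D₂.c : ℂ) * y F₂ / 2 ∈ D₂.L.lattice.toAddSubgroup := by
    intro y hy
    rw [Submodule.mem_toAddSubgroup, Submodule.mem_toAddSubgroup, ← D₁.uniformize_eq_zero_iff, ← D₂.uniformize_eq_zero_iff]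
    exact hker y hy
  exact sameKernel_depleted_of_sameKernel_twoOldLinesSets Q₁ Q₂ hQ₁ hQ₂ hdisj hQ₁N₂ hQ₂N₁ hL hL₂ D₁.f D₂.f
    (fun n ↦ W₁.LFunction n) (fun n ↦ W₂.LFunction n) D₁.isNewformOf.2 D₂.isNewformOf.2 hT₁ hT₂ hq₁ h₂₂ hq₂ h₁₁ S hS hSodd hQ₁S hQ₂S
    hAS N' hN' g₁ g₂ hg₁ hg₂ F₁ F₂ hF₁ hF₂ D₁.L.lattice.toAddSubgroup D₂.L.lattice.toAddSubgroup D₁.c D₂.c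
    (fun z hz ↦ D₁.smul_periodLattice_le z hz) (fun z hz ↦ D₂.smul_periodLattice_le z hz) hker' x hx

/-! ## §2 The inline cross-level stub of line `birth` on the two-sided shape, from PLANE(2) at the common level + the KO parities -/

/-- **The body of v27's inline stub `hCopyNe` ON THE SHAPE `N(W₁) = N₀·∏Q₁`, `N(W₂) = N₀·∏Q₂`** (`Q₁, Q₂` disjoint sets of primes not dividing `N₀` —
e.g. any two semistable curves, `…TwoSided.exists_semistableShape`), FROM `hPlane` — «at the common level `L = N(W₁)·∏Q₂`, for the old lines `F₁` of `f₁` (`a_n(F₁) = Σ_{T⊆Q₂}(∏T)·a_{n/∏T}(f₁)`)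
and `F₂` of `f₂` (`a_n(F₂) = Σ_{T⊆Q₁}(∏T)·a_{n/∏T}(f₂)`) and every cycle `y ∈ H₁(X₀(L);ℤ)`: `u₁(c₁·y(F₁)/2) = O ↔ u₂(c₂·y(F₂)/2) = O`» — and `hKO` —
«`a_q(W₁)` even for `q ∈ Q₂` and `a_q(W₂)` even for `q ∈ Q₁`» (Kraus–Oesterlé 1992 Prop. 3 at `p = 2`). `S`, `N'`, the old lines and the other parities
are discharged inside. [cite: GreenbergVatsal2000, §3] [cite: KrausOesterle1992, Prop. 3 (p. 262–263)] [cite: CremonaAlgorithms1997, §2.4 and §2.10] -/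
theorem sameDepletedKernel_semistableShape_of_twoOldLinesPlane
    (hPlane : ∀ (W₁ : WeierstrassCurve ℚ) [W₁.IsElliptic] [W₁.IsGloballyMinimal]
      (W₂ : WeierstrassCurve ℚ) [W₂.IsElliptic] [W₂.IsGloballyMinimal],
      IsOrdinaryAt W₁ 2 → IsOrdinaryAt W₂ 2 →
      (∀ x : ℚ, ¬ HasRationalTwoTorsionX W₁ x) → (∀ x : ℚ, ¬ HasRationalTwoTorsionX W₂ x) →
      ¬ IsSquare W₁.Δ → ¬ IsSquare W₂.Δ →
      (¬ ∃ (d : ℚ) (c : WeierstrassCurve.VariableChange ℚ), c • W₁.quadraticTwist d = W₂) →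
      OnKilfordStratumAtTwo W₁ →
      ∀ (N₀ : ℕ) (Q₁ Q₂ : Finset ℕ), (∀ q ∈ Q₁, q.Prime) → (∀ q ∈ Q₂, q.Prime) → Disjoint Q₁ Q₂ →
        (∀ q ∈ Q₁, ¬ q ∣ N₀) → (∀ q ∈ Q₂, ¬ q ∣ N₀) →
        W₁.conductorNorm ℤ = N₀ * ∏ q ∈ Q₁, q → W₂.conductorNorm ℤ = N₀ * ∏ q ∈ Q₂, q →
      ∀ (F : Type) [Field F] [NumberField F], Module.finrank ℚ F = 3 →
      ∀ e₁ e₂ : F, aeval e₁ (twoDivisionUCubic W₁) = 0 → aeval e₂ (twoDivisionUCubic W₂) = 0 →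
      AlignedAtTwo F e₁ e₂ → AlignedAtInfinity F (twoDivisionUCubic W₁) (twoDivisionUCubic W₂) e₁ e₂ →
      ∀ [NeZero (W₁.conductorNorm ℤ)] [NeZero (W₂.conductorNorm ℤ)]
        (D₁ : ModularParametrizationData W₁ (W₁.conductorNorm ℤ)) (D₂ : ModularParametrizationData W₂ (W₂.conductorNorm ℤ)),
        Odd D₁.c → Odd D₂.c →
      ∀ (L : ℕ) [NeZero L], L = W₁.conductorNorm ℤ * ∏ q ∈ Q₂, q →
      ∀ (F₁ F₂ : CuspForm (Gamma0 L) 2),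
        (∀ n : ℕ, cuspCoeff F₁ n =
          ∑ T ∈ Q₂.powerset, ((∏ q ∈ T, q : ℕ) : ℂ) * (if (∏ q ∈ T, q) ∣ n then cuspCoeff D₁.f (n / ∏ q ∈ T, q) else 0)) →
        (∀ n : ℕ, cuspCoeff F₂ n =
          ∑ T ∈ Q₁.powerset, ((∏ q ∈ T, q : ℕ) : ℂ) * (if (∏ q ∈ T, q) ∣ n then cuspCoeff D₂.f (n / ∏ q ∈ T, q) else 0)) →
      ∀ y ∈ periodHomology L,
        D₁.uniformize ((D₁.c : ℂ) * y F₁ / 2) = 0 ↔ D₂.uniformize ((D₂.c : ℂ) * y F₂ / 2) = 0)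
    (hKO : ∀ (W₁ : WeierstrassCurve ℚ) [W₁.IsElliptic] [W₁.IsGloballyMinimal]
      (W₂ : WeierstrassCurve ℚ) [W₂.IsElliptic] [W₂.IsGloballyMinimal],
      IsOrdinaryAt W₁ 2 → IsOrdinaryAt W₂ 2 →
      (∀ x : ℚ, ¬ HasRationalTwoTorsionX W₁ x) → (∀ x : ℚ, ¬ HasRationalTwoTorsionX W₂ x) →
      ¬ IsSquare W₁.Δ → ¬ IsSquare W₂.Δ →
      ∀ (N₀ : ℕ) (Q₁ Q₂ : Finset ℕ), (∀ q ∈ Q₁, q.Prime) → (∀ q ∈ Q₂, q.Prime) → Disjoint Q₁ Q₂ →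
        (∀ q ∈ Q₁, ¬ q ∣ N₀) → (∀ q ∈ Q₂, ¬ q ∣ N₀) →
        W₁.conductorNorm ℤ = N₀ * ∏ q ∈ Q₁, q → W₂.conductorNorm ℤ = N₀ * ∏ q ∈ Q₂, q →
      ∀ (F : Type) [Field F] [NumberField F], Module.finrank ℚ F = 3 →
      ∀ e₁ e₂ : F, aeval e₁ (twoDivisionUCubic W₁) = 0 → aeval e₂ (twoDivisionUCubic W₂) = 0 →
      (∀ q ∈ Q₂, Even (W₁.LFunction q)) ∧ (∀ q ∈ Q₁, Even (W₂.LFunction q))) :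
    ∀ (W₁ : WeierstrassCurve ℚ) [W₁.IsElliptic] [W₁.IsGloballyMinimal]
      (W₂ : WeierstrassCurve ℚ) [W₂.IsElliptic] [W₂.IsGloballyMinimal],
      IsOrdinaryAt W₁ 2 → IsOrdinaryAt W₂ 2 →
      (∀ x : ℚ, ¬ HasRationalTwoTorsionX W₁ x) → (∀ x : ℚ, ¬ HasRationalTwoTorsionX W₂ x) →
      ¬ IsSquare W₁.Δ → ¬ IsSquare W₂.Δ →
      (¬ ∃ (d : ℚ) (c : WeierstrassCurve.VariableChange ℚ), c • W₁.quadraticTwist d = W₂) →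
      OnKilfordStratumAtTwo W₁ →
      ∀ (N₀ : ℕ) (Q₁ Q₂ : Finset ℕ), (∀ q ∈ Q₁, q.Prime) → (∀ q ∈ Q₂, q.Prime) → Disjoint Q₁ Q₂ →
        (∀ q ∈ Q₁, ¬ q ∣ N₀) → (∀ q ∈ Q₂, ¬ q ∣ N₀) →
        W₁.conductorNorm ℤ = N₀ * ∏ q ∈ Q₁, q → W₂.conductorNorm ℤ = N₀ * ∏ q ∈ Q₂, q →
      ∀ (F : Type) [Field F] [NumberField F], Module.finrank ℚ F = 3 →
      ∀ e₁ e₂ : F, aeval e₁ (twoDivisionUCubic W₁) = 0 → aeval e₂ (twoDivisionUCubic W₂) = 0 →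
      AlignedAtTwo F e₁ e₂ → AlignedAtInfinity F (twoDivisionUCubic W₁) (twoDivisionUCubic W₂) e₁ e₂ →
      ∀ [NeZero (W₁.conductorNorm ℤ)] [NeZero (W₂.conductorNorm ℤ)]
        (D₁ : ModularParametrizationData W₁ (W₁.conductorNorm ℤ)) (D₂ : ModularParametrizationData W₂ (W₂.conductorNorm ℤ)),
        Odd D₁.c → Odd D₂.c →
      ∀ (N' : ℕ) [NeZero N'], N' = W₁.conductorNorm ℤ * W₂.conductorNorm ℤ *
          ∏ ℓ ∈ (W₁.conductorNorm ℤ * W₂.conductorNorm ℤ).primeFactors.erase 2, ℓ ^ 2 →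
      ∀ (g₁ g₂ : CuspForm (Gamma0 N') 2),
        (∀ n : ℕ, cuspCoeff g₁ n =
          if ∃ ℓ ∈ (W₁.conductorNorm ℤ * W₂.conductorNorm ℤ).primeFactors.erase 2, ℓ ∣ n then 0 else cuspCoeff D₁.f n) →
        (∀ n : ℕ, cuspCoeff g₂ n =
          if ∃ ℓ ∈ (W₁.conductorNorm ℤ * W₂.conductorNorm ℤ).primeFactors.erase 2, ℓ ∣ n then 0 else cuspCoeff D₂.f n) →
      ∀ x ∈ periodHomology N',
        D₁.uniformize ((D₁.c : ℂ) *
            ((((∏ ℓ ∈ (W₁.conductorNorm ℤ * W₂.conductorNorm ℤ).primeFactors.erase 2, ℓ ^ 2 : ℕ) : ℂ) * x g₁) / 2)) = 0 ↔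
          D₂.uniformize ((D₂.c : ℂ) *
            ((((∏ ℓ ∈ (W₁.conductorNorm ℤ * W₂.conductorNorm ℤ).primeFactors.erase 2, ℓ ^ 2 : ℕ) : ℂ) * x g₂) / 2)) = 0 := by
  intro W₁ _ _ W₂ _ _ hord₁ hord₂ ht₁ ht₂ hsq₁ hsq₂ htw hK N₀ Q₁ Q₂ hQ₁ hQ₂ hdisj hQ₁N₀ hQ₂N₀ hN₁ hN₂ F _ _ hF e₁ e₂ he₁ he₂ h2 hal _ _ D₁ D₂
    hc₁ hc₂ N' _ hN' g₁ g₂ hg₁ hg₂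
  classical
  set N₁ : ℕ := W₁.conductorNorm ℤ with hN₁def
  set N₂ : ℕ := W₂.conductorNorm ℤ with hN₂def
  have hN₁0 : N₁ ≠ 0 := NeZero.ne _
  have hN₂0 : N₂ ≠ 0 := NeZero.ne _
  haveI : Fact (Nat.Prime 2) := ⟨Nat.prime_two⟩
  have h2N₁ : ¬ 2 ∣ N₁ := not_dvd_level_of_isNewformOf D₁.isNewformOf hord₁.1
  have h2N₂ : ¬ 2 ∣ N₂ := not_dvd_level_of_isNewformOf D₂.isNewformOf hord₂.1
  have hQ₁0 : ∀ q ∈ Q₁, q ≠ 0 := fun q hq ↦ (hQ₁ q hq).ne_zero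
  have hQ₂0 : ∀ q ∈ Q₂, q ≠ 0 := fun q hq ↦ (hQ₂ q hq).ne_zero
  have hdvdQ : ∀ (Q : Finset ℕ), (∀ q ∈ Q, q.Prime) → ∀ ℓ : ℕ, ℓ.Prime → ℓ ∉ Q → ¬ ℓ ∣ ∏ q ∈ Q, q := by
    intro Q hQ ℓ hℓ hℓQ h
    obtain ⟨q, hq, hℓq⟩ := (Prime.dvd_finsetProd_iff hℓ.prime _).mp h
    exact hℓQ (((Nat.prime_dvd_prime_iff_eq hℓ (hQ q hq)).mp hℓq) ▸ hq)
  set S : Finset ℕ := (N₁ * N₂).primeFactors.erase 2 with hS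
  have hSp : ∀ ℓ ∈ S, ℓ.Prime := fun ℓ hℓ ↦ Nat.prime_of_mem_primeFactors (Finset.mem_of_mem_erase hℓ)
  have hSodd : ∀ ℓ ∈ S, Odd ℓ := fun ℓ hℓ ↦ (hSp ℓ hℓ).odd_of_ne_two (Finset.ne_of_mem_erase hℓ)
  have hQ₁S : Q₁ ⊆ S := by
    intro q hq
    have hqN₁ : q ∣ N₁ := by rw [hN₁]; exact (Finset.dvd_prod_of_mem _ hq).mul_left N₀
    refine Finset.mem_erase.mpr ⟨fun h ↦ h2N₁ (h ▸ hqN₁), Nat.mem_primeFactors.mpr ⟨hQ₁ q hq, hqN₁.mul_right N₂, mul_ne_zero hN₁0 hN₂0⟩⟩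
  have hQ₂S : Q₂ ⊆ S := by
    intro q hq
    have hqN₂ : q ∣ N₂ := by rw [hN₂]; exact (Finset.dvd_prod_of_mem _ hq).mul_left N₀
    refine Finset.mem_erase.mpr ⟨fun h ↦ h2N₂ (h ▸ hqN₂), Nat.mem_primeFactors.mpr ⟨hQ₂ q hq, hqN₂.mul_left N₁, mul_ne_zero hN₁0 hN₂0⟩⟩
  have hSN : ∀ ℓ ∈ S, ℓ ∉ Q₁ → ℓ ∉ Q₂ → ℓ ∣ N₀ := by
    intro ℓ hℓ h1 h2
    have hℓ' := (Nat.mem_primeFactors.mp (Finset.mem_of_mem_erase hℓ)).2.1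
    rw [hN₁, hN₂] at hℓ'
    rcases (Nat.Prime.dvd_mul (hSp ℓ hℓ)).mp hℓ' with h | h
    · rcases (Nat.Prime.dvd_mul (hSp ℓ hℓ)).mp h with h | h
      · exact h
      · exact absurd h (hdvdQ Q₁ hQ₁ ℓ (hSp ℓ hℓ) h1)
    · rcases (Nat.Prime.dvd_mul (hSp ℓ hℓ)).mp h with h | h
      · exact h
      · exact absurd h (hdvdQ Q₂ hQ₂ ℓ (hSp ℓ hℓ) h2)
  -- the common level `L = N₁·∏Q₂ = N₂·∏Q₁`
  haveI hL0 : NeZero (N₁ * ∏ q ∈ Q₂, q) := ⟨mul_ne_zero hN₁0 (Finset.prod_ne_zero_iff.mpr fun q hq ↦ hQ₂0 q hq)⟩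
  have hN'' : N₁ * (∏ q ∈ Q₂, q) * ∏ ℓ ∈ S, ℓ ^ 2 ∣ N' := ⟨N₀, by rw [hN', hN₂]; ring⟩
  have hL₂ : N₂ * ∏ q ∈ Q₁, q ∣ N₁ * ∏ q ∈ Q₂, q := ⟨1, by rw [hN₁, hN₂]; ring⟩
  obtain ⟨F₁, hF₁⟩ : ∃ F₁ : CuspForm (Gamma0 (N₁ * ∏ q ∈ Q₂, q)) 2, ∀ n : ℕ, cuspCoeff F₁ n =
      ∑ T ∈ Q₂.powerset, ((∏ q ∈ T, q : ℕ) : ℂ) * (if (∏ q ∈ T, q) ∣ n then cuspCoeff D₁.f (n / ∏ q ∈ T, q) else 0) :=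
    exists_oldLines Q₂ hQ₂0 dvd_rfl D₁.f
  obtain ⟨F₂, hF₂⟩ : ∃ F₂ : CuspForm (Gamma0 (N₁ * ∏ q ∈ Q₂, q)) 2, ∀ n : ℕ, cuspCoeff F₂ n =
      ∑ T ∈ Q₁.powerset, ((∏ q ∈ T, q : ℕ) : ℂ) * (if (∏ q ∈ T, q) ∣ n then cuspCoeff D₂.f (n / ∏ q ∈ T, q) else 0) :=
    exists_oldLines Q₁ hQ₁0 hL₂ D₂.f
  obtain ⟨hq₁, hq₂⟩ := hKO W₁ W₂ hord₁ hord₂ ht₁ ht₂ hsq₁ hsq₂ N₀ Q₁ Q₂ hQ₁ hQ₂ hdisj hQ₁N₀ hQ₂N₀ hN₁ hN₂ F hF e₁ e₂ he₁ he₂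
  exact uniformize_depleted_iff_of_twoOldLinesSets_conductor D₁ D₂ N₀ Q₁ Q₂ hQ₁ hQ₂ hdisj hQ₁N₀ hQ₂N₀ hN₁ hN₂ rfl hq₁ hq₂ S hSp hSodd
    hQ₁S hQ₂S hSN N' hN'' g₁ g₂ hg₁ hg₂ F₁ F₂ hF₁ hF₂
    (hPlane W₁ W₂ hord₁ hord₂ ht₁ ht₂ hsq₁ hsq₂ htw hK N₀ Q₁ Q₂ hQ₁ hQ₂ hdisj hQ₁N₀ hQ₂N₀ hN₁ hN₂ F hF e₁ e₂ he₁ he₂ h2 hal D₁ D₂ hc₁ hc₂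
      (N₁ * ∏ q ∈ Q₂, q) rfl F₁ F₂ hF₁ hF₂)

end Summit.BirchSwinnertonDyer.BirchSwinnertonDyer.Theorems.AlignedTransportAtTwoKilfordCopyCrossLevelSemistable

end
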